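import Summits.HodgeConjecture.CorCM.Census.CyclicCharacterSubBalancedLinearisation

/-!
# Cyclic characters, XLIV: THE ODD-STABILISED BALANCED TYPE for every `k` — balance, the owned face with `t'` in the top fibre, its corners, the reindexings

COR-CM (cell `pub-hodgecm2`), count-neutral kernel combinatorics by the binder seat b09 (gen 44; lane CYCLIC-CHARACTER FIBRE LAW, part XLIV — the `k ≥ 3`
version of part XXXVII, cf. `HOME/pub-hodgecm2-b09/lean-g44/LOWER-RULE-ROADMAP.md`), on parts XXXIV, XXXVII, XLI–XLIII BY NAME.  Theorems only (no
definition, no `decide`, no certificate, no named fact, no `sorry`).  HONEST FRAMING: `HC_CM` is NOT proved, here or anywhere in the tree; nothing here is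
a period or a headline.

SETTING: `w : G ↠ ℤ/2ᵏ` (`k ≥ 2`, `h = 2ᵏ⁻¹`), `w c = h`, kernel of size `n = 2m`, `Ψ·g⁻¹ = Ψ` with `w g = 1` (lit-andre-3ʼs fixed type of a non-root).
* §1 **BALANCE**: every fibre deviation of `Ψ` equals `m` (`card_fib_sdiff_eq_of_rt_eq`); `bpot Ψ = ddist T_0 Ψ = h·m` (`Ψ` is sub-balanced, part XLI).
* §2 THE ELEMENTS: for `t' ∈ F_{h−1} ∖ Ψ` and `s ∈ F_0 ∩ Ψ`: `b' = t'·g⁻¹ ∈ F_{h−2} ∖ Ψ`, `v_s = c·s·g⁻¹ ∈ F_{h−1} ∖ Ψ`, `s_{t'} = c·t'·g ∈ F_0 ∩ Ψ`.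
* §3 THE CORNERS of the owned face `gface Ψ s t'`: `X₁ = Ψ^{(t')}`, `Ψ^{(s)} = Y₂·g`, `Ψ^{(s t')} = Y₃·g` (`Y₂ = Ψ^{(v_s)}`, `Y₃ = Ψ^{(v_s)(b')}`), with the
  deviation sets `(T_0∖Ψ)∖t'`, `(T_0∖Ψ)∖v_s`, `((T_0∖Ψ)∖b')∖v_s` and the sub-balance bounds part XLIII consumes (`x_j ≤ m` for `j < h`, `x_{h−1} < m`).
* §4 THE REINDEXINGS of the relation: `(D ∖ F_{h−1})·g = D ∖ F_0` (`D = T_0 ∖ Ψ`) and `c·((F_{h−1} ∖ Ψ) ∖ t')·g = F_0 ∖ ((F_0 ∖ Ψ) ∪ {s_{t'}})`.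

## References
* [Pohlmann1968] H. Pohlmann, Algebraic cycles on abelian varieties of complex multiplication type, Ann. of Math. 88 (1968), Thm 1.
-/

namespace Summit.HodgeConjecture.CorCM.Census.CyclicCharacter

open Finset
open Summit.HodgeConjecture.CorCM.Prior.AllgGroup.RfwfAllgGroup
open Summit.HodgeConjecture.CorCM.Census.BlockParity
open Summit.HodgeConjecture.CorCM.Census.Coinvariant
open Summit.HodgeConjecture.CorCM.Census.TwistGeneration
open Summit.HodgeConjecture.CorCM.Census.BaseBlock

noncomputable section

variable {G : Type*} [Group G] [Fintype G] [DecidableEq G] {k : ℕ} {w : G → ZMod (2 ^ k)} {c : G}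

/-! ## §1 Balance -/

/-- **A type fixed by `g` with `w g = 1` has all fibre deviations equal**: `x_j(Ψ) = x_0(Ψ)`. [folklore] -/
theorem card_fib_sdiff_eq_zero_of_rt_eq (hw : ∀ P Q : G, w (P * Q) = w P + w Q) {Ψ : CMF G c} {g : G} (hΨ : rt c g Ψ = Ψ) (hg : w g = 1)
    (j : ZMod (2 ^ k)) : ((univ.filter fun s : G => w s = j) \ Ψ.1).card = ((univ.filter fun s : G => w s = 0) \ Ψ.1).card := by
  haveI : NeZero (2 ^ k) := ⟨pow_ne_zero _ two_ne_zero⟩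
  have step : ∀ i : ZMod (2 ^ k), ((univ.filter fun s : G => w s = i) \ Ψ.1).card = ((univ.filter fun s : G => w s = i + 1) \ Ψ.1).card := by
    intro i
    have h := card_fib_sdiff_rt hw g Ψ i
    rw [hΨ, hg] at h
    exact h
  have key : ∀ t : ℕ, ((univ.filter fun s : G => w s = (t : ZMod (2 ^ k))) \ Ψ.1).card = ((univ.filter fun s : G => w s = 0) \ Ψ.1).card := by
    intro t
    induction t with
    | zero => rw [Nat.cast_zero]
    | succ t ih => rw [Nat.cast_succ, ← step, ih]
  rw [← ZMod.natCast_zmod_val j]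
  exact key j.val

/-- **BALANCE for every `k`**: `x_j(Ψ) = m` for every `j`, and `bpot Ψ = ddist T_0 Ψ`. [folklore] -/
theorem card_fib_sdiff_eq_of_rt_eq (hw : ∀ P Q : G, w (P * Q) = w P + w Q) (hk : 1 ≤ k) (hc2 : c * c = 1) (hwc : w c ≠ 0)
    (h1 : ∃ g₁ : G, w g₁ = 1) {m : ℕ} (hm : 2 * m = (univ.filter fun s : G => w s = 0).card) {Ψ : CMF G c} {g : G} (hΨ : rt c g Ψ = Ψ)
    (hg : w g = 1) (j : ZMod (2 ^ k)) : ((univ.filter fun s : G => w s = j) \ Ψ.1).card = m := by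
  have h0 := card_fib_sdiff_add_half hw hk hc2 hwc h1 Ψ 0
  rw [zero_add, card_fib_sdiff_eq_zero_of_rt_eq hw hΨ hg ((2 ^ (k - 1) : ℕ) : ZMod (2 ^ k))] at h0
  rw [card_fib_sdiff_eq_zero_of_rt_eq hw hΨ hg j]
  omega

/-- **The balanced type is far and `T_0` is nearest**: `bpot Ψ = ddist T_0 Ψ` and `2 ≤ bpot Ψ` (`m ≥ 2`). [folklore] -/
theorem bpot_of_rt_eq (hw : ∀ P Q : G, w (P * Q) = w P + w Q) (hk : 1 ≤ k) (hc2 : c * c = 1) (hwc : w c ≠ 0)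
    (h1 : ∃ g₁ : G, w g₁ = 1) {m : ℕ} (hm : 2 * m = (univ.filter fun s : G => w s = 0).card) (hm2 : 2 ≤ m) {Ψ : CMF G c} {g : G}
    (hΨ : rt c g Ψ = Ψ) (hg : w g = 1) :
    bpot c (arcType hw hk hc2 hwc 0) Ψ = ddist (arcType hw hk hc2 hwc 0) Ψ ∧ 2 ≤ bpot c (arcType hw hk hc2 hwc 0) Ψ := by
  have hx := card_fib_sdiff_eq_of_rt_eq hw hk hc2 hwc h1 hm hΨ hg
  obtain ⟨hb, -, -⟩ := bpot_eq_ddist_zero_of_subBalanced hw hk hc2 hwc h1 hm (X := Ψ) fun j _ => (hx _).le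
  refine ⟨hb, ?_⟩
  rw [hb, ddist_arcType_eq_sum hw hk hc2 hwc]
  have hh1 : 1 ≤ 2 ^ (k - 1) := Nat.one_le_two_pow
  have hle : ((univ.filter fun s : G => w s = (0 : ZMod (2 ^ k)) + ((0 : ℕ) : ZMod (2 ^ k))) \ Ψ.1).card ≤
      ∑ i ∈ range (2 ^ (k - 1)), ((univ.filter fun s : G => w s = (0 : ZMod (2 ^ k)) + (i : ZMod (2 ^ k))) \ Ψ.1).card :=
    Finset.single_le_sum (s := range (2 ^ (k - 1))) (f := fun i : ℕ => ((univ.filter fun s : G => w s = (0 : ZMod (2 ^ k)) + (i : ZMod (2 ^ k))) \ Ψ.1).card)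
      (fun _ _ => Nat.zero_le _) (mem_range.mpr hh1)
  have hx0 := hx ((0 : ZMod (2 ^ k)) + ((0 : ℕ) : ZMod (2 ^ k)))
  omega

/-! ## §2 The elements -/

/-- `b' = t'·g⁻¹`: `w b' = w t' − 1` and `b' ∉ Ψ`. [folklore] -/
theorem bprimeK_spec (hw : ∀ P Q : G, w (P * Q) = w P + w Q) {Ψ : CMF G c} {g : G} (hΨ : rt c g Ψ = Ψ) (hg : w g = 1)
    {t' : G} (ht'Ψ : t' ∉ Ψ.1) : w (t' * g⁻¹) = w t' - 1 ∧ t' * g⁻¹ ∉ Ψ.1 :=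
  ⟨by rw [hw, map_inv hw, hg, sub_eq_add_neg], fun h => ht'Ψ ((mul_inv_mem_iff_of_rt_eq hΨ t').mp h)⟩

/-- `v_s = c·s·g⁻¹` for `s ∈ F_0 ∩ Ψ`: `w v_s = h − 1` and `v_s ∉ Ψ`. [folklore] -/
theorem vsK_spec (hw : ∀ P Q : G, w (P * Q) = w P + w Q) (hk : 1 ≤ k) (hc2 : c * c = 1) (hwc : w c ≠ 0)
    {Ψ : CMF G c} {g : G} (hΨ : rt c g Ψ = Ψ) (hg : w g = 1) {s : G} (hs0 : w s = 0) (hsΨ : s ∈ Ψ.1) :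
    w (c * (s * g⁻¹)) = ((2 ^ (k - 1) : ℕ) : ZMod (2 ^ k)) - 1 ∧ c * (s * g⁻¹) ∉ Ψ.1 := by
  refine ⟨?_, fun h => ((cmul_mem_iff Ψ _).mp h) ((mul_inv_mem_iff_of_rt_eq hΨ s).mpr hsΨ)⟩
  rw [hw, hw, map_inv hw, apply_c hw hk hc2 hwc, hs0, hg, zero_add, sub_eq_add_neg]

/-- `s_{t'} = c·t'·g` for `t' ∈ F_{h−1} ∖ Ψ`: `w s_{t'} = 0` and `s_{t'} ∈ Ψ`. [folklore] -/
theorem stK_spec (hw : ∀ P Q : G, w (P * Q) = w P + w Q) (hk : 1 ≤ k) (hc2 : c * c = 1) (hwc : w c ≠ 0)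
    {Ψ : CMF G c} {g : G} (hΨ : rt c g Ψ = Ψ) (hg : w g = 1) {t' : G} (ht'1 : w t' = ((2 ^ (k - 1) : ℕ) : ZMod (2 ^ k)) - 1) (ht'Ψ : t' ∉ Ψ.1) :
    w (c * (t' * g)) = 0 ∧ c * (t' * g) ∈ Ψ.1 := by
  refine ⟨?_, (cmul_mem_iff Ψ _).mpr fun h => ht'Ψ ((mem_iff_mul_mem_of_rt_eq hΨ t').mpr h)⟩
  rw [hw, hw, apply_c hw hk hc2 hwc, ht'1, hg, sub_add_cancel, half_add_half hk]

omit [Group G] [Fintype G] [DecidableEq G] in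
/-- `h − 1` as a cast: `((h − 1 : ℕ) : ℤ/2ᵏ) = h − 1`. [folklore] -/
theorem natCast_half_sub_one : ((2 ^ (k - 1) - 1 : ℕ) : ZMod (2 ^ k)) = ((2 ^ (k - 1) : ℕ) : ZMod (2 ^ k)) - 1 := by
  rw [Nat.cast_sub Nat.one_le_two_pow, Nat.cast_one]

/-! ## §3 The corners of the owned face -/

/-- **The deviation coordinates of a one-point extension**: for `q ∈ T_0 ∖ Ψ` and a type `X` with `T_0 ∖ X = (T_0 ∖ Ψ) ∖ q`-like deviation `D' ⊆ T_0 ∖ Ψ`,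
`x_j(X) ≤ m` for `j < h`; stated for an arbitrary sub-deviation. [folklore] -/
theorem card_fib_sdiff_le_of_sub (hw : ∀ P Q : G, w (P * Q) = w P + w Q) (hk : 1 ≤ k) (hc2 : c * c = 1) (hwc : w c ≠ 0)
    (h1 : ∃ g₁ : G, w g₁ = 1) {m : ℕ} (hm : 2 * m = (univ.filter fun s : G => w s = 0).card) {Ψ : CMF G c} {g : G} (hΨ : rt c g Ψ = Ψ)
    (hg : w g = 1) {X : CMF G c} (hX : (arcType hw hk hc2 hwc 0).1 \ X.1 ⊆ (arcType hw hk hc2 hwc 0).1 \ Ψ.1) :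
    ∀ j : ℕ, j < 2 ^ (k - 1) → ((univ.filter fun s : G => w s = (j : ZMod (2 ^ k))) \ X.1).card ≤ m :=
  fun _ hj => (card_fib_sdiff_le_of_sdiff_subset_of_lt hw hk hc2 hwc hX hj).trans (card_fib_sdiff_eq_of_rt_eq hw hk hc2 hwc h1 hm hΨ hg _).le

/-- **Removing a top point lowers `x_{h−1}` below `m`**: if `T_0 ∖ X ⊆ (T_0 ∖ Ψ) ∖ q` with `w q = h − 1`, `q ∈ T_0 ∖ Ψ`, then `x_{h−1}(X) < m`. [folklore] -/
theorem card_top_sdiff_lt_of_sub_erase (hw : ∀ P Q : G, w (P * Q) = w P + w Q) (hk : 1 ≤ k) (hc2 : c * c = 1) (hwc : w c ≠ 0)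
    (h1 : ∃ g₁ : G, w g₁ = 1) {m : ℕ} (hm : 2 * m = (univ.filter fun s : G => w s = 0).card) {Ψ : CMF G c} {g : G} (hΨ : rt c g Ψ = Ψ)
    (hg : w g = 1) {q : G} (hq : w q = ((2 ^ (k - 1) - 1 : ℕ) : ZMod (2 ^ k))) (hqD : q ∈ (arcType hw hk hc2 hwc 0).1 \ Ψ.1)
    {X : CMF G c} (hX : (arcType hw hk hc2 hwc 0).1 \ X.1 ⊆ ((arcType hw hk hc2 hwc 0).1 \ Ψ.1).erase q) :
    ((univ.filter fun s : G => w s = ((2 ^ (k - 1) - 1 : ℕ) : ZMod (2 ^ k))) \ X.1).card < m := by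
  have hh : 2 ^ (k - 1) - 1 < 2 ^ (k - 1) := by have := Nat.one_le_two_pow (n := k - 1); omega
  rw [fib_sdiff_eq_filter_of_lt hw hk hc2 hwc X hh]
  have hsub : ((arcType hw hk hc2 hwc 0).1 \ X.1).filter (fun s => w s = ((2 ^ (k - 1) - 1 : ℕ) : ZMod (2 ^ k))) ⊆
      ((((arcType hw hk hc2 hwc 0).1 \ Ψ.1).filter fun s => w s = ((2 ^ (k - 1) - 1 : ℕ) : ZMod (2 ^ k))).erase q) := by
    intro x hx
    rw [mem_filter] at hx
    have hx' := hX hx.1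
    exact mem_erase.mpr ⟨ne_of_mem_erase hx', mem_filter.mpr ⟨mem_of_mem_erase hx', hx.2⟩⟩
  have hqmem : q ∈ ((arcType hw hk hc2 hwc 0).1 \ Ψ.1).filter fun s => w s = ((2 ^ (k - 1) - 1 : ℕ) : ZMod (2 ^ k)) := mem_filter.mpr ⟨hqD, hq⟩
  have hcardq : (((arcType hw hk hc2 hwc 0).1 \ Ψ.1).filter fun s => w s = ((2 ^ (k - 1) - 1 : ℕ) : ZMod (2 ^ k))).card = m := by
    rw [← fib_sdiff_eq_filter_of_lt hw hk hc2 hwc Ψ hh, card_fib_sdiff_eq_of_rt_eq hw hk hc2 hwc h1 hm hΨ hg]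
  have hm1 : 0 < m := hcardq ▸ card_pos.mpr ⟨q, hqmem⟩
  have hcard := card_le_card hsub
  rw [card_erase_of_mem hqmem, hcardq] at hcard
  omega

/-- **The corner `X₁ = Ψ^{(t')}`** (`t' ∈ F_{h−1} ∖ Ψ`): deviation `(T_0 ∖ Ψ) ∖ t'`. [folklore] -/
theorem cornerK_one_dev (hw : ∀ P Q : G, w (P * Q) = w P + w Q) (hk : 1 ≤ k) (hc2 : c * c = 1) (hwc : w c ≠ 0) (Ψ : CMF G c)
    {t' : G} (ht'1 : w t' = ((2 ^ (k - 1) - 1 : ℕ) : ZMod (2 ^ k))) (ht'Ψ : t' ∉ Ψ.1) :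
    t' ∈ (arcType hw hk hc2 hwc 0).1 \ Ψ.1 ∧ (arcType hw hk hc2 hwc 0).1 \ (oflipCM c hc2 t' Ψ).1 = ((arcType hw hk hc2 hwc 0).1 \ Ψ.1).erase t' := by
  have ht'T : t' ∈ (arcType hw hk hc2 hwc 0).1 :=
    (mem_arcType_iff_exists hw hk hc2 hwc 0 t').mpr ⟨2 ^ (k - 1) - 1, by have := Nat.one_le_two_pow (n := k - 1); omega, by rw [ht'1, zero_add]⟩
  exact ⟨mem_sdiff.mpr ⟨ht'T, ht'Ψ⟩, dev_oflip c hc2 ht'T ht'Ψ⟩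

/-- **The corner `Ψ^{(s)} = Y₂·g`** with `Y₂ = Ψ^{(v_s)}`: `rt g⁻¹ Y₂ = Ψ^{(s)}`, deviation of `Y₂` = `(T_0 ∖ Ψ) ∖ v_s`, `v_s ∈ T_0 ∖ Ψ` with
`w v_s = h − 1`. [folklore] -/
theorem cornerK_two_spec (hw : ∀ P Q : G, w (P * Q) = w P + w Q) (hk : 1 ≤ k) (hc2 : c * c = 1) (hwc : w c ≠ 0)
    {Ψ : CMF G c} {g : G} (hΨ : rt c g Ψ = Ψ) (hg : w g = 1) {s : G} (hs0 : w s = 0) (hsΨ : s ∈ Ψ.1) :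
    rt c g⁻¹ (oflipCM c hc2 (c * (s * g⁻¹)) Ψ) = oflipCM c hc2 s Ψ ∧
    w (c * (s * g⁻¹)) = ((2 ^ (k - 1) - 1 : ℕ) : ZMod (2 ^ k)) ∧ c * (s * g⁻¹) ∈ (arcType hw hk hc2 hwc 0).1 \ Ψ.1 ∧
    (arcType hw hk hc2 hwc 0).1 \ (oflipCM c hc2 (c * (s * g⁻¹)) Ψ).1 = ((arcType hw hk hc2 hwc 0).1 \ Ψ.1).erase (c * (s * g⁻¹)) := by
  obtain ⟨hv1, hvΨ⟩ := vsK_spec hw hk hc2 hwc hΨ hg hs0 hsΨ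
  rw [← natCast_half_sub_one] at hv1
  obtain ⟨hvD, hdev⟩ := cornerK_one_dev hw hk hc2 hwc Ψ hv1 hvΨ
  refine ⟨?_, hv1, hvD, hdev⟩
  rw [rt_oflipCM, rt_inv_eq_self_of_rt_eq hΨ, inv_inv, mul_assoc, inv_mul_cancel_right, oflipCM_cmul]

/-- **The corner `Ψ^{(s)(t')} = Y₃·g`** with `Y₃ = Ψ^{(v_s)(b')}`: `rt g⁻¹ Y₃ = Ψ^{(s)(t')}` and the deviation of `Y₃` is `((T_0 ∖ Ψ) ∖ b') ∖ v_s` with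
`b' ∈ (T_0 ∖ Ψ) ∖ v_s` (`k ≥ 2`). [folklore] -/
theorem cornerK_three_spec (hw : ∀ P Q : G, w (P * Q) = w P + w Q) (hk : 1 ≤ k) (hk2 : 2 ≤ k) (hc2 : c * c = 1) (hwc : w c ≠ 0)
    {Ψ : CMF G c} {g : G} (hΨ : rt c g Ψ = Ψ) (hg : w g = 1) {s t' : G} (hs0 : w s = 0) (hsΨ : s ∈ Ψ.1)
    (ht'1 : w t' = ((2 ^ (k - 1) - 1 : ℕ) : ZMod (2 ^ k))) (ht'Ψ : t' ∉ Ψ.1) :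
    rt c g⁻¹ (oflipCM c hc2 (c * (s * g⁻¹)) (oflipCM c hc2 (t' * g⁻¹) Ψ)) = oflipCM c hc2 s (oflipCM c hc2 t' Ψ) ∧
    t' * g⁻¹ ∈ ((arcType hw hk hc2 hwc 0).1 \ Ψ.1).erase (c * (s * g⁻¹)) ∧ w (t' * g⁻¹) = ((2 ^ (k - 1) - 2 : ℕ) : ZMod (2 ^ k)) ∧
    (arcType hw hk hc2 hwc 0).1 \ (oflipCM c hc2 (c * (s * g⁻¹)) (oflipCM c hc2 (t' * g⁻¹) Ψ)).1 =
      (((arcType hw hk hc2 hwc 0).1 \ Ψ.1).erase (t' * g⁻¹)).erase (c * (s * g⁻¹)) := by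
  have hh2 : 2 ≤ 2 ^ (k - 1) := le_trans (pow_one 2).symm.le (Nat.pow_le_pow_right (by norm_num) (by omega))
  obtain ⟨hb', hb'Ψ⟩ := bprimeK_spec hw hΨ hg ht'Ψ
  have hb'w : w (t' * g⁻¹) = ((2 ^ (k - 1) - 2 : ℕ) : ZMod (2 ^ k)) := by
    rw [hb', ht'1, Nat.cast_sub (by omega : 1 ≤ 2 ^ (k - 1)), Nat.cast_sub hh2]; push_cast; ring
  obtain ⟨hv1, hvΨ⟩ := vsK_spec hw hk hc2 hwc hΨ hg hs0 hsΨ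
  rw [← natCast_half_sub_one] at hv1
  have hb'T : t' * g⁻¹ ∈ (arcType hw hk hc2 hwc 0).1 := (mem_arcType_iff_exists hw hk hc2 hwc 0 _).mpr ⟨2 ^ (k - 1) - 2, by omega, by rw [hb'w, zero_add]⟩
  have hvT : c * (s * g⁻¹) ∈ (arcType hw hk hc2 hwc 0).1 := (mem_arcType_iff_exists hw hk hc2 hwc 0 _).mpr ⟨2 ^ (k - 1) - 1, by omega, by rw [hv1, zero_add]⟩
  have hne : c * (s * g⁻¹) ≠ t' * g⁻¹ := fun h => by
    have := congrArg w h; rw [hv1, hb'w] at this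
    have := natCast_inj_of_lt_half hk (by omega) (by omega) this; omega
  have hvflip : c * (s * g⁻¹) ∉ (oflipCM c hc2 (t' * g⁻¹) Ψ).1 := by
    rw [mem_oflipCM_iff' hc2, not_not, mem_orb]
    refine ⟨fun h => absurd h hvΨ, ?_⟩
    rintro (h | h)
    · exact (hne h).elim
    · exfalso
      -- `c·s·g⁻¹ = c·t'·g⁻¹` would give `s = t'`, but `w s = 0 ≠ h − 1 = w t'`
      have hst : s = t' := mul_right_cancel (mul_left_cancel h)
      have e := hs0.symm.trans (hst ▸ ht'1 : w s = _)
      rw [← Nat.cast_zero] at e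
      have := natCast_inj_of_lt_half hk (by omega) (by omega) e
      omega
  refine ⟨?_, mem_erase.mpr ⟨hne.symm, mem_sdiff.mpr ⟨hb'T, hb'Ψ⟩⟩, hb'w, by rw [dev_oflip c hc2 hvT hvflip, dev_oflip c hc2 hb'T hb'Ψ]⟩
  rw [rt_oflipCM, rt_oflipCM, rt_inv_eq_self_of_rt_eq hΨ, inv_inv, mul_assoc, inv_mul_cancel_right, inv_mul_cancel_right, oflipCM_cmul]

/-! ## §4 The reindexing bijections of the relation -/

/-- **`(D ∖ F_{h−1})·g = D ∖ F_0`** (`D = T_0 ∖ Ψ`): right multiplication by `g` moves the deviation one fibre up. [folklore] -/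
theorem image_lo_mul_eq (hw : ∀ P Q : G, w (P * Q) = w P + w Q) (hk : 1 ≤ k) (hc2 : c * c = 1) (hwc : w c ≠ 0)
    {Ψ : CMF G c} {g : G} (hΨ : rt c g Ψ = Ψ) (hg : w g = 1) :
    (((arcType hw hk hc2 hwc 0).1 \ Ψ.1).filter fun q => w q ≠ ((2 ^ (k - 1) - 1 : ℕ) : ZMod (2 ^ k))).image (fun q => q * g) =
      ((arcType hw hk hc2 hwc 0).1 \ Ψ.1).filter fun q => w q ≠ 0 := by
  have hh1 : 1 ≤ 2 ^ (k - 1) := Nat.one_le_two_pow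
  ext p
  rw [mem_image, mem_filter, mem_sdiff, mem_arcType_iff_exists hw hk hc2 hwc]
  constructor
  · rintro ⟨q, hq, rfl⟩
    rw [mem_filter, mem_sdiff, mem_arcType_iff_exists hw hk hc2 hwc] at hq
    obtain ⟨⟨⟨i, hi, hwq⟩, hqΨ⟩, hne⟩ := hq
    rw [zero_add] at hwq
    have hi' : i + 1 < 2 ^ (k - 1) := by
      by_contra h
      have : i = 2 ^ (k - 1) - 1 := by omega
      exact hne (by rw [hwq, this])
    refine ⟨⟨⟨i + 1, hi', by rw [hw, hwq, hg, zero_add, Nat.cast_succ]⟩, fun h => hqΨ ((mem_iff_mul_mem_of_rt_eq hΨ q).mpr h)⟩, fun h => ?_⟩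
    rw [hw, hwq, hg, ← Nat.cast_succ, ← Nat.cast_zero] at h
    have := natCast_inj_of_lt_half hk hi' (by omega) h
    omega
  · rintro ⟨⟨⟨i, hi, hwp⟩, hpΨ⟩, hne⟩
    rw [zero_add] at hwp
    have hi1 : 1 ≤ i := by
      by_contra h
      have : i = 0 := by omega
      exact hne (by rw [hwp, this, Nat.cast_zero])
    refine ⟨p * g⁻¹, mem_filter.mpr ⟨mem_sdiff.mpr ⟨(mem_arcType_iff_exists hw hk hc2 hwc 0 _).mpr ⟨i - 1, by omega, ?_⟩, fun h => hpΨ ?_⟩, fun h => ?_⟩,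
      inv_mul_cancel_right p g⟩
    · rw [hw, map_inv hw, hwp, hg, zero_add, Nat.cast_sub hi1, Nat.cast_one, sub_eq_add_neg]
    · exact (mul_inv_mem_iff_of_rt_eq hΨ p).mp h
    · rw [hw, map_inv hw, hwp, hg] at h
      have e : ((i - 1 : ℕ) : ZMod (2 ^ k)) = ((2 ^ (k - 1) - 1 : ℕ) : ZMod (2 ^ k)) := by
        rw [← h, Nat.cast_sub hi1, Nat.cast_one, sub_eq_add_neg]
      have := natCast_inj_of_lt_half hk (by omega) (by omega) e
      omega

/-- **`c·((F_{h−1} ∖ Ψ) ∖ t')·g = F_0 ∖ ((F_0 ∖ Ψ) ∪ {s_{t'}})`**: the top deviation, less `t'`, reindexes the bottom points of `Ψ` other than `s_{t'}`.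
[folklore] -/
theorem image_top_erase_eq_gen (hw : ∀ P Q : G, w (P * Q) = w P + w Q) (hk : 1 ≤ k) (hc2 : c * c = 1) (hwc : w c ≠ 0)
    {Ψ : CMF G c} {g : G} (hΨ : rt c g Ψ = Ψ) (hg : w g = 1) (t' : G) :
    (((univ.filter fun s : G => w s = ((2 ^ (k - 1) - 1 : ℕ) : ZMod (2 ^ k))) \ Ψ.1).erase t').image (fun q => c * (q * g)) =
      (univ.filter fun s : G => w s = 0) \ insert (c * (t' * g)) ((univ.filter fun s : G => w s = 0) \ Ψ.1) := by
  have hwq : ∀ q : G, w q = ((2 ^ (k - 1) - 1 : ℕ) : ZMod (2 ^ k)) → w (c * (q * g)) = 0 := fun q hq => by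
    rw [hw, hw, apply_c hw hk hc2 hwc, hq, hg, natCast_half_sub_one, sub_add_cancel, half_add_half hk]
  ext p
  rw [mem_image, mem_sdiff, mem_insert, mem_sdiff, mem_filter]
  constructor
  · rintro ⟨q, hq, rfl⟩
    rw [mem_erase, mem_sdiff, mem_filter] at hq
    obtain ⟨hqt, ⟨-, hq1⟩, hqΨ⟩ := hq
    refine ⟨⟨mem_univ _, hwq q hq1⟩, ?_⟩
    rintro (h | ⟨-, h⟩)
    · exact hqt (mul_right_cancel (mul_left_cancel h))
    · exact h ((cmul_mem_iff Ψ _).mpr fun h' => hqΨ ((mem_iff_mul_mem_of_rt_eq hΨ q).mpr h'))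
  · rintro ⟨⟨-, hp0⟩, hp⟩
    have hpΨ : p ∈ Ψ.1 := by by_contra h; exact hp (Or.inr ⟨⟨mem_univ _, hp0⟩, h⟩)
    refine ⟨c * (p * g⁻¹), mem_erase.mpr ⟨fun h => hp (Or.inl ?_), mem_sdiff.mpr ⟨mem_filter.mpr ⟨mem_univ _, ?_⟩, fun h => ?_⟩⟩, ?_⟩
    · rw [← h, mul_assoc, inv_mul_cancel_right, ← mul_assoc, hc2, one_mul]
    · rw [hw, hw, map_inv hw, apply_c hw hk hc2 hwc, hp0, hg, zero_add, natCast_half_sub_one, sub_eq_add_neg]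
    · exact ((cmul_mem_iff Ψ _).mp h) ((mul_inv_mem_iff_of_rt_eq hΨ p).mpr hpΨ)
    · rw [mul_assoc, inv_mul_cancel_right, ← mul_assoc, hc2, one_mul]

end

end Summit.HodgeConjecture.CorCM.Census.CyclicCharacter
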